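import Mathlib
import HarnessLib
import HarnessLib.Audit
import Summits.HodgeConjecture.Statement
import Literature.AlgebraicGeometry.HodgeTheory.ComplexGysinCorrespondence
import Literature.AlgebraicGeometry.HodgeTheory.CycleClassOfResolutions
import Literature.AlgebraicGeometry.HodgeTheory.ComplexOrientationFamily
import Literature.AlgebraicGeometry.HodgeTheory.ComplexOrientationDegreeFormulaHolds
import Literature.AlgebraicGeometry.HodgeTheory.ComplexOrientationCycleClassFacts
import Literature.AlgebraicGeometry.HodgeTheory.SupportedClassesOfCorrespondenceDecomposition
import Literature.Barriers.HodgeConjecture.DecompositionOfTheDiagonalProofs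
import Literature.AlgebraicGeometry.Motives.CyclesDimensionProofs
import Summits.HodgeConjecture.HodgeConjecture.Theorems.LinearSystemTorelliTranscendentalOrSupportedStubOfMiddleOfHodgeEffective
import HarnessLib.Audit.Status.Attr

/-!
Route: HodgeProjectorDivisorSupport

# Route HodgeProjectorDivisorSupport — the orthogonal Hodge projector is algebraic and supported on
a divisor cross

X = W2 ∧ W3 ("it suffices to show"). For X smooth projective of even dimension 2n (n ≥ 1) let P be
the ORTHOGONAL HODGE
PROJECTOR on H^{2n}(X(ℂ); ℂ): the identity on the rational (n,n)-classes and zero on their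
cup-orthogonal (well defined and
unique because the cup pairing on Hdg^n(X) is nondegenerate, Hodge–Riemann). W2
(`HodgeProjectorAlgebraic`): P is the action
`corrAction complexOrientationFamily` of an ALGEBRAIC class π ∈ N^{2n}H^{4n}(X × X). W3
(`HodgeProjectorDivisorSupported`): whenever
such a π exists, a nonzero multiple u·P is the action of the cycle class of a 2n-cycle Z′ + Z″ on X
× X with Z′ over D × X and Z″
over X × D for a proper Zariski-closed D ⊊ X (a two-sided Bloch–Srinivas decomposition of the
projector, not of the diagonal). Then
P c = c for every rational (n,n)-class c, and the tree's S1 theorem puts u·c, hence c, in N¹H^{2n}: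
middle-degree divisor support,
which the tree's closed reduction chain (divisor induction + pencils + hard Lefschetz) turns into
HC. Card realised: hodge-projector-divisor-support (spine; W2 = its K2, W3 = its K1 in cycle form).
Lean:
`Summit.HodgeConjecture.HodgeConjecture.Theses.HodgeProjectorDivisorSupport.HodgeProjectorAlgebraic
∧
Summit.HodgeConjecture.HodgeConjecture.Theses.HodgeProjectorDivisorSupport.HodgeProjectorDivisorSupported`

## Assembly
`closes (hW2 : HodgeProjectorAlgebraic) (hW3 : HodgeProjectorDivisorSupported) : HodgeConjecture` is
PROVED in glue.lean (sorry-free,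
elaborated): take the standard complex-orientation Gysin formalism G
(`exists_gysinFormalism_isGysinHodgeCompatible_complexOrientation` with
both named facts discharged, `…_holds`), whose Gysin maps are `complexGysin
complexOrientationFamily` and whose cycle classes are
`cycleClass complexOrientationFamily … ρ₀`; feed W3 at ρ₀ with W2's witness;
`GysinFormalism.corrAct_apply`/`corrAction_apply` identify
G.corrAct (Z′+Z″) with the real action, so G.corrAct (Z′+Z″) c = u • c on rational (p,p)-classes;
`corrAct_mem_supportedClasses_one_of_decomposition`
(m = 1, T = W = D, d = 2p−1 < l = 2p, heights from `one_le_coheight_of_isClosed_of_ne_univ` +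
`height_add_coheight_eq_of_smoothOfRelativeDimension`)
gives u • c ∈ N¹, `Submodule.smul_mem_iff` gives c ∈ N¹ =
`LinearSystemTorelli.MiddleDivisorSupport`, and
`Theorems.hodgeConjecture_of_middleDivisorSupport` (Thomas2005Nodes Thm 1 in tree form: divisor
induction, pencils, hard Lefschetz — all landed) gives HC.

Rationale: WHY THIS LINE. Isolate the Hodge summand of Voisin's cohomological decomposition [Δ_X] = δ_alg +
δ_{≥c} (Voisin2025 §5.2–5.3, formula (42), Prop. 5.5) as an
object in its own right — the orthogonal projector P onto Hdg^n — and split HC in the middle degree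
into algebraicity of P (W2, a
standard-conjecture-type statement that is a THEOREM wherever End/Lefschetz correspondences generate
the Hodge classes: abelian varieties of
Weil type via Σ q_β[Γ_β]^*, divisorial sectors via Σ g^{ij} D_i × D_j, KahnMurrePedrini's π₂^alg for
n = 1) and a SUPPORT statement (W3)
whose output is exactly what the Bloch–Srinivas mechanism consumes (BlochSrinivas1983 Prop. 1;
VoisinHodgeII2003 (10.8)–(10.9), in the tree as
`GysinFormalism.corrAct_mem_supportedClasses_one_of_decomposition`). Imported: intersection theory
of correspondences and coniveau (algebraic
cycles), Hodge–Riemann nondegeneracy (Kähler geometry) to pin P, and — for the attack on W3 in the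
Weil sector — Kimura finite-dimensionality /
Beauville decomposition of 0-cycles on abelian varieties (arXiv:1803.00857). Unlike the dead line
ch0-null-correspondence-support on
LinearSystemTorelli.MiddleDivisorSupport it never asks for CH₀-nullity of a correspondence (open
Bloch–Beilinson at p = 1) but for the
support OUTPUT, which is implied by HC and elementary at n = 1; unlike a decomposition of Δ_X it
survives h^{2n,0} ≠ 0.

RANKED CRUXES. #2 HodgeProjectorDivisorSupported (crux) — W3 (card K1, cycle form): for X smooth
projective of dimension 2n ≥ 2 and any resolution family ρ of X × X (a NONEMPTY type:
`nonempty_resolutionFamily (IsSmoothProjective.tensor_holds hX hX) (2*n)`; `cycleClass` is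
ρ-independent by `cycleClass_eq_of_hasDegreeFormula
Fulton1998_degreeFormula_complexOrientation_holds`), IF some algebraic class π on X × X acts
(corrAction of the complex orientation) as the orthogonal Hodge projector of H^{2n}(X) (identity on
rational (n,n)-classes, zero on their cup-orthogonal), THEN there are a proper Zariski-closed D ⊊ X,
2n-cycles Z′ (every component with first projection in D) and Z″ (second projection in D) on X × X
and u ≠ 0 such that the cycle class of Z′ + Z″ acts as u·(that projector). [deps:
HodgeProjectorAlgebraic] [difficulty: open-problem] (why it might fail: implied by HC (π^Hdg = Σ
g^ij[Z_i × Z_j] ⊂ D×D), so only the PLAN can fail: outside End/Lefschetz sectors the only tool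
moving an algebraic projector onto a divisor cross is decomposition-of-the-diagonal spreading, which
needs CH₀-smallness X lacks when h^{2n,0} ≠ 0.) [BlochSrinivas1983, VoisinHodgeII2003, Voisin2025,
arXiv:1803.00857, doi:10.1017/cbo9781107325968.009]
#3 HodgeProjectorAlgebraic (crux) — W2 (card K2): for X smooth projective of dimension 2n ≥ 2 there
is an algebraic class π ∈ N^{2n}H^{4n}((X × X)(ℂ); ℂ) whose correspondence action on H^{2n}(X(ℂ); ℂ)
is the identity on every rational (n,n)-class and kills every class cup-orthogonal to all rational
(n,n)-classes. [difficulty: open-problem] (why it might fail: true under HC (π^Hdg is a rational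
(2n,2n)-class on X×X); unconditionally known only where End/Lefschetz correspondences span Hdg
(abelian Weil type, divisorial sectors); for K3×K3-type transcendental Hodge morphisms it is as hard
as the class itself.) [Kleiman1968, Andre1996, Voisin2025, Markman2025,
doi:10.1017/cbo9781107325968.009]

TWO-LAYER PLAN. W3 ⇐ (ProjectorCycle: W2's class is, up to u ≠ 0, the class of an integral 2n-cycle
Z acting as u·P — rational descent + purity) → (CrossDecomposition:
every such projector cycle is homologically equivalent to a cross-supported Z′ + Z″) → W3; later
W3-in-sectors: abelian Weil type (Beauville/Kimura
0-cycle identity z_W = 0 in CH₀(A_ℂ(A))), divisorial sectors (provable now), general X. W2 ⇐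
(Künneth–Hodge projector CLASS exists, pure Hodge theory)
→ (that rational (2n,2n)-class is algebraic) → W2. k ≤ 3 each, depth 1.

KILL CRITERIA. ¬W3 exhibited for one X carrying a W2-witness (e.g. an abelian 2n-fold of Weil type
whose Weil classes provably have coniveau 0) refutes W3 AND HC —
close `refuted:HodgeProjectorDivisorSupported` and hand the witness to the negative side. ¬W2 for
some X (a non-algebraic orthogonal Hodge projector)
also refutes HC (π^Hdg is a Hodge class on X × X). A proof that W3's cycle form is strictly stronger
than its class form in some sector forces a
pivot to the class-level W3 (restate). MiddleDivisorSupport (stmt-HodgeConjecture-1081) proved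
elsewhere moots the route.

NOT DECOMPOSED YET. The projector-cycle lemma (class → integral cycle, rational descent), the
Chow-level strengthening W3♯ (m·Z ∼_rat Z′ + Z″, localisation on
U × U), the Weil-sector dictionary (Beauville decomposition, Pontryagin products) and the
divisorial-sector calibration are layer-2 children /
prover lemmas, not items; no sector split of W2 at open.

CHEAPEST FALSIFIER. In-Lean: the BC7 tautology probe on both cruxes (run: CLEAN expected —
conclusion needs the W2 hypothesis; D = ∅ forces Z′ = Z″ = 0, impossible since
h^n ∈ Hdg^n is a nonzero rational (n,n)-class for n ≥ 1). Literature: is "Weil classes on a generic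
abelian fourfold/sixfold of Weil type have
coniveau ≥ 1" already refuted or proved independently of Markman2025? (searched: no hits for "Weil
classes coniveau" in corpus(fts+vec) and galaxy;
Markman2025 proves algebraicity, hence coniveau n, for sixfolds of discriminant −1 only.)

NUMBERS. Known regime of S used for calibration: p = 1 (Lefschetz (1,1)); abelian fourfolds and
Weil-type sixfolds of discriminant −1 (Markman2025,
arXiv:2502.03415 p. 2); uniruled / CH₀-small fourfolds (BlochSrinivas1983). Items at open: 2 cruxes;
closes proved.
Ladder ceiling (BC9): method_family=correspondence-coniveau bloch-srinivas
decomposition-of-projector; ladder_ceiling=capped-at-CH-small (decomposition-of-the-diagonal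
spreading decomposes a correspondence off a proper closed subset only under CH-triviality
hypotheses: Bloch–Srinivas needs CH₀ supported in small dimension, Voisin II Thm 10.29/10.31 need cl
injective on CH_l, l ≤ k−1 [corpus:book:voisin2003-hodge-theory-complex-algebraic-geometry-ii
p.282], [Literature/Barriers/HodgeConjecture/DecompositionOfTheDiagonal.lean],
[Literature/Barriers/HodgeConjecture/GeneralisedDecompositionOfTheDiagonal.lean]; End/Lefschetz
sectors: Kleiman1968, Andre1996, arXiv:1803.00857; galaxy: [galaxy:panama:426979878764584 p.116]
Murre, Chow–Künneth decomposition of the diagonal, no divisor-cross statement; no hits for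
"supported on a divisor" in galaxy pdf/crabby); ceiling_lift=HodgeProjectorDivisorSupported for X
with h^{2n,0} ≠ 0 outside the End/Lefschetz sectors [declared-crux: HodgeProjectorDivisorSupported];
ceiling_sources=[VoisinHodgeII2003:Thm 10.29–10.31 (p.282), BlochSrinivas1983:Thm 1,
Literature/Barriers/HodgeConjecture/DecompositionOfTheDiagonal.lean,
Literature/Barriers/HodgeConjecture/GeneralisedDecompositionOfTheDiagonal.lean].

DEFINITION REQUESTS. None: corrAction, cycleClass, ResolutionFamily, complexOrientationFamily,
algebraicClasses, supportedClasses, IsOfHodgeType, IsRationalClass,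
cupProduct, cyclesOfDim all exist (lean search --decl). The orthogonal Hodge projector is pinned
inline (no new def) to avoid a Literature
round-trip; a later T0 move may name it `IsOrthogonalHodgeProjector`.

Novelty: Searches (2026-08-17): `lit search --hybrid "projector onto Hodge classes algebraic correspondence
supported on divisor coniveau"` (8 textbook
hits: voisin2002 p.235–237, green1994 (Murre CIME lectures) p.143–168, voisin2003 p.48/110,
kerr2016); `lit vsearch "<W3 in prose>"` (10, same
books + deligne1982); `lit search "Vial generic cycles Lefschetz representations…"` (held
paper:arxiv-1803.00857); `lit search "Kahn Murre Pedrini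
transcendental part of the motive"` (doi:10.1017/cbo9781107325968.009, held book:nagel2007 p.149);
`lit search "Markman abelian 2n-folds Weil type
secant"` (held paper:arxiv-2502.03415, 2509.23079, 2509.23403); `lit galaxy search "transcendental
part of the motive|Chow-Kunneth projector|projector
onto the algebraic part" --star all` (7: panama:375551940362301 Nagel–Peters,
pdf:-6776688330456012040 Fu–Vial cubic fourfolds, pdf:1622905177953002360
Akhtar–Joshua); `lit galaxy search "decomposition of the diagonal|Bloch-Srinivas" --star all` (20:
panama:203229262512160 Birational Geometry of
Hypersurfaces, panama:426979878764584 Transcendental Aspects, pdf:-1259855189697000220 Fu–Vial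
distinguished cycles); earlier this seat: `lit frontier
HodgeConjecture --since 2020`, `lit bridges HodgeConjecture --cross any`, Voisin2025 §5 read pp.
29–31.
Nearest prior art found: Voisin2025 (doi:10.56994/jomp.001.001.002) §5.2–5.3 — cohomological
decomposition of the diagonal [Δ_X] = δ_alg + δ_{≥c},
Prop. 5.5/5.15 (one-sided D_c × X support ⇒ H* = H*_alg + N^c, partial  [refs: 10.1017/cbo9781107325968.009, 10.56994/jomp.001.001.002, 1803.00857, paper:arxiv-1803.00857, doi:10.1017/cbo9781107325968.009, book:nagel2007, paper:arxiv-2502.03415, doi:10.56994/jomp.001.001.002, Voisin2025]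

Barriers (technique_class: hodge-projector, correspondence-coniveau): - technique_class: hodge-projector, correspondence-coniveau
- Literature.Barriers.HodgeConjecture.BlochSrinivas1983_hodgeTypeL0_vanish_of_chowZeroSupported:
(crux HodgeProjectorDivisorSupported = W3; W2 not concerned) OUTSIDE its class — the barrier (and
the Paranjape–Laterveer generalisation it quotes, VoisinHodgeII2003 Thm 10.29/10.31, file
GeneralisedDecompositionOfTheDiagonal) constrains decompositions of m·Δ_X obtained from
CH-smallness, which force H^{l,0} = 0; W3 decomposes only u·π^Hdg, whose action kills H^{2n,0} by
construction (the D × X side lands in N¹, the X × D side factors through H^{2n,0}(D̃) = 0), assumes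
nothing on CH_*(X), and never uses the GHC-strength conclusion of 10.29/10.31; conceded: the
spreading TOOLS behind the barrier are the only known engine for W3 outside End/Lefschetz sectors —
the bet is that spreading the vanishing of π on the cup-orthogonal of Hdg (not of Δ) needs no CH₀
hypothesis.
- Literature.Barriers.HodgeConjecture.Weil1977_exceptionalHodgeClasses: (W2 =
HodgeProjectorAlgebraic, residual; W3's abelian rung) outside — Weil's exceptional classes lie
outside the DIVISOR RING; W3 asks support on a divisor CROSS (coniveau 1), not generation by divisor
classes; Weil classes on Weil-type fourfolds are algebraic (Markman2025, arXiv:2502.03415) hence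
divisor-supported although not in the divisor ring. Same placement for
Mumford1968_simpleFourfold_exceptionalHodgeClasses.
- Literature.Barriers.HodgeConjecture.Grothendieck1969_generalHodgeConje

sub-problem: HodgeConjecture · status: draft · opened planner-type-6d6105befd-0 2026-08-17T16:20:14Z · rev 0 · ledger route-HodgeConjecture-HodgeProjectorDivisorSupport
GENERATED by the gate from the ledger (D-0016/17). Provers cite these decls: `theorem foo : Summit.HodgeConjecture.HodgeConjecture.Theses.HodgeProjectorDivisorSupport.<Decl> := …` in Summits/HodgeConjecture/HodgeConjecture/Theorems/<Name>.lean.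
-/

namespace Summit.HodgeConjecture.HodgeConjecture.Theses.HodgeProjectorDivisorSupport

open scoped BigOperators Topology Manifold Classical MeasureTheory ProbabilityTheory Matrix InnerProductSpace ComplexConjugate ContinuousMap
open Filter Set Function TopologicalSpace MeasureTheory

attribute [summit_statement] _root_.HodgeConjecture

/-- item stmt-HodgeConjecture-18704 · crux · rank 2 · open · by planner
why it might fail: implied by HC (π^Hdg = Σ g^ij[Z_i × Z_j] ⊂ D×D), so only the PLAN can fail: outside End/Lefschetz sectors the only tool moving an algebraic projector onto a divisor cross is decomposition-of-the-diagonal spreading, which needs CH₀-smallness X lacks when h^{2n,0} ≠ 0.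
sources: BlochSrinivas1983, VoisinHodgeII2003, Voisin2025, arXiv:1803.00857, doi:10.1017/cbo9781107325968.009
[crux] W3 (card K1, cycle form): for X smooth projective of dimension 2n ≥ 2 and any resolution
family ρ of X × X (a NONEMPTY type: `nonempty_resolutionFamily (IsSmoothProjective.tensor_holds hX
hX) (2*n)`; `cycleClass` is ρ-independent by `cycleClass_eq_of_hasDegreeFormula
Fulton1998_degreeFormula_complexOrientation_holds`), IF some algebraic class π on X × X acts
(corrAction of the complex orientation) as the orthogonal Hodge projector of H^{2n}(X) (identity on
rational (n,n)-classes, zero on their cup-orthogonal), THEN there are a proper Zariski-closed D ⊊ X,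
2n-cycles Z′ (every component with first projection in D) and Z″ (second projection in D) on X × X
and u ≠ 0 such that the cycle class of Z′ + Z″ acts as u·(that projector). [deps:
HodgeProjectorAlgebraic] [difficulty: open-problem] -/
@[route_item "route-HodgeConjecture-HodgeProjectorDivisorSupport", crux]
def HodgeProjectorDivisorSupported : Prop :=
  open CategoryTheory MonoidalCategory CartesianMonoidalCategory AlgebraicGeometry Literature.AlgebraicGeometry.Motives Literature.AlgebraicGeometry.HodgeTheory Literature.AlgebraicTopology.SingularHomology in ∀ (n : ℕ) (X : SchemeOver ℂ) (hX : IsSmoothProjective (2 * n) X) (ρ : ResolutionFamily (X ⊗ X) (2 * n)), 1 ≤ n → (∃ π ∈ algebraicClasses (X ⊗ X) (2 * n), (∀ c : complexBetti X (2 * n), IsRationalClass c → IsOfHodgeType (2 * n) X (2 * n) n n c → corrAction complexOrientationFamily hX hX (rfl : 2 * n + 2 * (2 * n) = 2 * n + 2 * (2 * n)) π c = c) ∧ (∀ b : complexBetti X (2 * n), (∀ a : complexBetti X (2 * n), IsRationalClass a → IsOfHodgeType (2 * n) X (2 * n) n n a → cupProduct (rfl : 2 * n + 2 * n = 2 * n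 + 2 * n) a b = 0) → corrAction complexOrientationFamily hX hX (rfl : 2 * n + 2 * (2 * n) = 2 * n + 2 * (2 * n)) π b = 0)) → ∃ D : Set X.left, IsClosed D ∧ D ≠ Set.univ ∧ ∃ (Z' Z'' : ↥(cyclesOfDim (X ⊗ X).left (2 * n))) (u : ℂ), u ≠ 0 ∧ (∀ z, (Z' : AlgebraicCycle (X ⊗ X).left ℤ) z ≠ 0 → (fst X X).left.base z ∈ D) ∧ (∀ z, (Z'' : AlgebraicCycle (X ⊗ X).left ℤ) z ≠ 0 → (snd X X).left.base z ∈ D) ∧ (∀ c : complexBetti X (2 * n), IsRationalClass c → IsOfHodgeType (2 * n) X (2 * n) n n c → corrAction complexOrientationFamily hX hX (rfl : 2 * n + 2 * (2 * n) = 2 * n + 2 * (2 * n)) (cycleClass complexOrientationFamily (IsSmoothProjective.tensor_holds hX hX) (rfl : 2 * n + 2 * n = 2 * n + 2 * n) ρ (Z' + Z'')) c = u • c) ∧ (∀ b : complexBetti X (2 * n), (∀ a : complexBetti X (2 * n), IsRationalClass a → IsOfHodgeType (2 * n) X (2 * n) n n a → cupProduct (rfl : 2 * n + 2 * n = 2 *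 n + 2 * n) a b = 0) → corrAction complexOrientationFamily hX hX (rfl : 2 * n + 2 * (2 * n) = 2 * n + 2 * (2 * n)) (cycleClass complexOrientationFamily (IsSmoothProjective.tensor_holds hX hX) (rfl : 2 * n + 2 * n = 2 * n + 2 * n) ρ (Z' + Z'')) b = 0)

/-- item stmt-HodgeConjecture-18705 · crux · rank 3 · open · by planner
why it might fail: true under HC (π^Hdg is a rational (2n,2n)-class on X×X); unconditionally known only where End/Lefschetz correspondences span Hdg (abelian Weil type, divisorial sectors); for K3×K3-type transcendental Hodge morphisms it is as hard as the class itself.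
sources: Kleiman1968, Andre1996, Voisin2025, Markman2025, doi:10.1017/cbo9781107325968.009
[crux] W2 (card K2): for X smooth projective of dimension 2n ≥ 2 there is an algebraic class π ∈
N^{2n}H^{4n}((X × X)(ℂ); ℂ) whose correspondence action on H^{2n}(X(ℂ); ℂ) is the identity on every
rational (n,n)-class and kills every class cup-orthogonal to all rational (n,n)-classes.
[difficulty: open-problem] -/
@[route_item "route-HodgeConjecture-HodgeProjectorDivisorSupport", crux]
def HodgeProjectorAlgebraic : Prop :=
  open CategoryTheory MonoidalCategory CartesianMonoidalCategory Literature.AlgebraicGeometry.Motives Literature.AlgebraicGeometry.HodgeTheory Literature.AlgebraicTopology.SingularHomology in ∀ (n : ℕ) (X : SchemeOver ℂ) (hX : IsSmoothProjective (2 * n) X), 1 ≤ n → ∃ π ∈ algebraicClasses (X ⊗ X) (2 * n), (∀ c : complexBetti X (2 * n), IsRationalClass c → IsOfHodgeType (2 * n) X (2 * n) n n c → corrAction complexOrientationFamily hX hX (rfl : 2 * n + 2 * (2 * n) = 2 * n + 2 * (2 * n)) π c = c) ∧ (∀ b : complexBetti X (2 * n), (∀ a : complexBetti X (2 * n), IsRationalClass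 a → IsOfHodgeType (2 * n) X (2 * n) n n a → cupProduct (rfl : 2 * n + 2 * n = 2 * n + 2 * n) a b = 0) → corrAction complexOrientationFamily hX hX (rfl : 2 * n + 2 * (2 * n) = 2 * n + 2 * (2 * n)) π b = 0)

/-- item stmt-HodgeConjecture-18706 · assembly · rank 1 · closed · proved by Summit.HodgeConjecture.HodgeConjecture.Theorems.hodgeProjectorDivisorSupport_assembly_proof @ 8ec2238f2dd8 (prover) · by planner
sources: BlochSrinivas1983, VoisinHodgeII2003, Thomas2005Nodes
[assembly] HodgeProjectorAlgebraic → HodgeProjectorDivisorSupported → HodgeConjecture (the deciding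
theorem `closes` of glue.lean proves exactly this, sorry-free). -/
@[route_item "route-HodgeConjecture-HodgeProjectorDivisorSupport"]
def Assembly : Prop :=
  HodgeProjectorAlgebraic → HodgeProjectorDivisorSupported → _root_.HodgeConjecture

/-! D-0027 §2.1 — DECIDING THEOREM (planner-authored via `route open/edit --closes-file`; by planner-type-6d6105befd-0 2026-08-17T16:20:14Z):
its hypotheses are this route's items and its conclusion the sub-problem Statement (glue_lint), and it elaborates with this file. -/

@[closes "route-HodgeConjecture-HodgeProjectorDivisorSupport"] theorem closes (hW2 : HodgeProjectorAlgebraic) (hW3 : HodgeProjectorDivisorSupported) :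
    _root_.HodgeConjecture := by
  classical
  refine Summit.HodgeConjecture.HodgeConjecture.Theorems.hodgeConjecture_of_middleDivisorSupport ?_
  intro p X hp hX c hc hh
  -- the standard (complex-orientation) Gysin formalism: its Gysin maps are `complexGysin` and its
  -- cycle classes are `cycleClass complexOrientationFamily … ρ` for some resolution family `ρ`
  obtain ⟨G, -, hgys, hcl⟩ :=
    Literature.AlgebraicGeometry.HodgeTheory.exists_gysinFormalism_isGysinHodgeCompatible_complexOrientation
      Literature.AlgebraicGeometry.HodgeTheory.Fulton1998_degreeFormula_complexOrientation_holds
      Literature.AlgebraicGeometry.HodgeTheory.Voisin2003_cycleClass_div_eq_zero_complexOrientation_holds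
  obtain ⟨ρ, hρ⟩ := hcl (Literature.AlgebraicGeometry.Motives.IsSmoothProjective.tensor_holds hX hX)
    (rfl : 2 * p + 2 * p = 2 * p + 2 * p)
  -- W3 fed with the W2 witness: a cross-supported cycle `Z' + Z''` acting as `u • π^{Hdg}`
  obtain ⟨D, hD, hDne, Z', Z'', u, hu, hZ'D, hZ''D, hid, -⟩ := hW3 p X hX ρ hp (hW2 p X hX hp)
  -- the action of `Z' + Z''` in the formalism `G` is the real `corrAction` of its cycle class
  have hkey : G.corrAct hX hX (2 * p) (Z' + Z'') c = u • c := by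
    rw [Literature.AlgebraicGeometry.HodgeTheory.GysinFormalism.corrAct_apply, hgys, hρ]
    exact hid c hc hh
  -- every point of the proper closed `D` has dimension `≤ 2p - 1`
  have hWd : ∀ w ∈ D, Order.height w ≤ ((2 * p - 1 : ℕ) : ℕ∞) := by
    intro w hw
    have hco : ((1 : ℕ) : ℕ∞) ≤ Order.coheight w :=
      Literature.Barriers.HodgeConjecture.one_le_coheight_of_isClosed_of_ne_univ hX hD hDne w hw
    haveI := hX.smoothOfRelativeDimension
    haveI := Literature.Barriers.HodgeConjecture.irreducibleSpace_of_isSmoothProjective hX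
    have hsum := Literature.AlgebraicGeometry.Motives.height_add_coheight_eq_of_smoothOfRelativeDimension
      X.hom (2 * p) w
    have hfin : Order.height w ≠ ⊤ := by
      intro h
      rw [h, top_add] at hsum
      exact (ENat.coe_ne_top _ hsum.symm).elim
    have hfin' : Order.coheight w ≠ ⊤ := by
      intro h
      rw [h, add_top] at hsum
      exact (ENat.coe_ne_top _ hsum.symm).elim
    obtain ⟨a, ha⟩ := ENat.ne_top_iff_exists.mp hfin
    obtain ⟨b, hb⟩ := ENat.ne_top_iff_exists.mp hfin'
    rw [← ha, ← hb] at hsum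
    rw [← hb] at hco
    rw [← ha]
    have h1 : a + b = 2 * p := by exact_mod_cast hsum
    have h2 : 1 ≤ b := by exact_mod_cast hco
    exact_mod_cast (show a ≤ 2 * p - 1 by omega)
  -- `1 • (Z' + Z'') ∼_rat Z' + Z''`
  have hrat : Literature.AlgebraicGeometry.Motives.IsRationallyEquivalent
      ((1 • (Z' + Z'') : ↥(Literature.AlgebraicGeometry.Motives.cyclesOfDim
        (CategoryTheory.MonoidalCategoryStruct.tensorObj X X).left (2 * p))) :
          AlgebraicGeometry.AlgebraicCycle (CategoryTheory.MonoidalCategoryStruct.tensorObj X X).left ℤ)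
      ((Z' + Z'' : ↥(Literature.AlgebraicGeometry.Motives.cyclesOfDim
        (CategoryTheory.MonoidalCategoryStruct.tensorObj X X).left (2 * p))) :
          AlgebraicGeometry.AlgebraicCycle (CategoryTheory.MonoidalCategoryStruct.tensorObj X X).left ℤ)
      (2 * p) := by
    rw [one_nsmul]
    exact Literature.AlgebraicGeometry.Motives.IsRationallyEquivalent.refl _
  -- S1: a cross-supported correspondence acts into `N¹` (Bloch–Srinivas / Voisin II (10.8)–(10.9))
  have hmem := G.corrAct_mem_supportedClasses_one_of_decomposition hX (Z' + Z'') Z' Z'' Nat.one_pos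
    hD hDne hZ'D hWd hZ''D hrat (show 2 * p - 1 < 2 * p by omega) c
  rw [hkey] at hmem
  exact (Submodule.smul_mem_iff _ hu).1 hmem

end Summit.HodgeConjecture.HodgeConjecture.Theses.HodgeProjectorDivisorSupport
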